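/-
Copyright: the b2b-balaban T⁴-continuum CRUX team, row NE7b OWNER lineage `t4-ne7b-p1` (gen 146). Project licence.
-/
import Summits.QuantumFields.BalabanUV.T4Continuum.Spine.NE7b.SupHomogeneousVertexBounds

/-!
# THE FOUR-POINT DISPLAY WITH ONE BOUNDED VERTEX — GIBBS FORMAT (SCOPING-d17 §F, F11: the homogeneous bound behind the
# interpolation of the SUPPORTED TREE terms `𝟙[Hk ≠ 0]·C4·T16` of `M₅` ((610), pieces (604))).  The fourth-cumulant display
#   `E[B̂F̂ĜĤ] − E[B̂F̂]E[ĜĤ] − E[B̂Ĝ]E[F̂Ĥ] − E[B̂Ĥ]E[F̂Ĝ]`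
# with ONE bounded centred vertex `B = P∘(A·+ψ)`, `|P| ≤ β`, and three gradient legs is bounded by `8β·√M₁·√√M₁` ((673)
# `centred_quad_le_of_bounded_first∕second` on the whitened tilted law with the fourth-moment letter `M₁ = 5κ₂⁴γ_op²∕(1−λγ_op)²` of (465)),
# vertex FIRST (the `x`-slot Hessian `U″[e_x,e_y]` of (609)'s group five) or SECOND (the pair Hessians of (608)'s group four); then
# the tilted transport under `N(0,AAᵀ)` is the next file (row NE7b, node U5c; (465), (673), (674) BY
# NAME; [folklore]).

Cell `pub-balaban`, sub-cell `t4`, spine estimate NE7b (`T4WeightBudget.RelWeightBound`; the cell's OWN estimate — NOT PRINTED in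
[Bałaban 1983–89], NOT PROVED).  Crux-route work under `Spine/NE7b/` by the row OWNER (`t4-ne7b-p1` gen 146, file (676)) under FREEZE
(0)'s crux-prover clause; NOTHING of Bałaban's is named as a Lean object, valued or asserted; no `T4Continuum/Support` leaf typed; no
`def`, no notation (every display WRITTEN OUT); zero `sorry`.  Imports (BY NAME): the OWNER's (674) `…SupHomogeneousVertexBounds` ((673) through
it).

WHAT IS PROVED ([folklore]): **`gibbs_quad_vertex_first`**, **`gibbs_quad_vertex_second`** (Gibbs format; the tilted transport is the next
file); toy.

HONEST (what this is NOT).  Moment inequalities and their format transport; the interpolated order-5 entries `M₅′` and their weighted slot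
letters are the next files; scalar skeleton ((A3), NC-NE7b-α UNRULED); nothing of Bałaban's asserted.  BY-NAME EFFECT ON THE WALL: NONE.  NE7b
NOT PRINTED ∕ NOT PROVED; spine PROVED 0∕9; rung (B)+1 — the programme's measures remain FINITE-torus statements; NOT the mass gap, NOT Clay.
HONEST DEPENDENCY: continuum YM on T⁴ ⇐ BetaPertH ∧ nine spine estimates (0∕9 proved); BetaPertH ⇐ (D1) ∧ (D4) ∧ CAP+tail; G-an2-4 gates
asym, D1 and NE2∕3∕4.
-/

set_option autoImplicit false
set_option maxSynthPendingDepth 2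

noncomputable section

namespace Summit.QuantumFields.BalabanUV.T4Continuum.NE7b.SupHomogeneousFourPointBounds

open MeasureTheory ProbabilityTheory Real Set Function Finset Matrix
open scoped BigOperators
open Literature.Probability.Distributions (matrixCLM)
open SupWhitenedFourthMoment (whitened_fourth_moment_gibbs whitened_fourth_power_integrable)
open SupWhitenedMomentLetters (op_letter_nonneg whitened_exp_integrable)
open SupWhitenedCovarianceKernelLetter (whitened_integrable_lebesgue)
open SupEffectiveActionDerivative (mul_opBound_le_of_le)
open SupHomogeneousVertexBoundsAbstract (centred_quad_le_of_bounded_first centred_quad_le_of_bounded_second)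
open SupHomogeneousVertexBounds (abs_sub_integral_le)

variable {ι κ : Type} [Fintype ι] [DecidableEq ι] [Fintype κ] [DecidableEq κ]

variable {U : EuclideanSpace ℝ ι → ℝ} {U' : EuclideanSpace ℝ ι → EuclideanSpace ℝ ι →L[ℝ] ℝ}
  {U'' : EuclideanSpace ℝ ι → EuclideanSpace ℝ ι →L[ℝ] EuclideanSpace ℝ ι →L[ℝ] ℝ}
  {A : Matrix ι κ ℝ} {γop κ₀ κ₁ κ₂ a τ δ θp lam : ℝ}

/-! ## §1. Gibbs format -/

/-- **FOUR-POINT DISPLAY, BOUNDED VERTEX FIRST (Gibbs format)**: for `|P| ≤ β` and gradient legs `z, t, s`,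
`|E[P̂ẐT̂Ŝ] − E[P̂Ẑ]E[T̂Ŝ] − E[P̂T̂]E[ẐŜ] − E[P̂Ŝ]E[ẐT̂]| ≤ 8β·√M₁·√√M₁`. [folklore] -/
theorem gibbs_quad_vertex_first [Nonempty κ] (hΓop : (γop • (1 : Matrix ι ι ℝ) - A * Aᵀ).PosSemidef) (Y : Finset ι)
    (hUd : ∀ φ : EuclideanSpace ℝ ι, HasFDerivAt U (U' φ) φ) (hU'd : ∀ φ : EuclideanSpace ℝ ι, HasFDerivAt U' (U'' φ) φ) (hU''c : Continuous U'')
    (hκ₀ : 0 ≤ κ₀) (hκ₁ : 0 ≤ κ₁) (ha : 0 ≤ a) (hτ : 0 < τ) (hδ : 0 < δ) (hθ0 : 0 < θp) (hθ1 : θp < 1) (hκθ : (2 * κ₀ * (1 + τ) + 4 * δ) * γop ≤ θp)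
    (hstab : ∀ φ : EuclideanSpace ℝ ι, -(κ₀ * ∑ x ∈ Y, φ x ^ 2) ≤ U φ) (hU'b : ∀ φ : EuclideanSpace ℝ ι, ‖U' φ‖ ≤ κ₁ * (a + ∑ x ∈ Y, φ x ^ 2))
    (hU''b : ∀ φ : EuclideanSpace ℝ ι, ‖U'' φ‖ ≤ κ₂) (hlam : 0 ≤ lam)
    (hUsec : ∀ s : ℝ, 0 ≤ s → s ≤ 1 → ∀ a b : EuclideanSpace ℝ ι, U ((1 - s) • a + s • b) - lam / 2 * (s * (1 - s)) * ∑ i, (a i - b i) ^ 2 ≤ (1 -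
        s) * U a + s * U b)
    (hρ : lam * γop < 1) {P : EuclideanSpace ℝ ι → ℝ} {β : ℝ} (hβ : 0 ≤ β) (hP : ∀ φ, |P φ| ≤ β) (ψ : EuclideanSpace ℝ ι) (z t s : ι) :
    |(∫ w, (P (matrixCLM A (WithLp.toLp 2 w) + ψ) - ∫ w', P (matrixCLM A (WithLp.toLp 2 w') + ψ) ∂((volume : Measure (κ → ℝ)).tilted fun z => -(1
        / 2 * (z ⬝ᵥ z) + U (matrixCLM A (WithLp.toLp 2 z) + ψ)))) * (U' (matrixCLM A (WithLp.toLp 2 w) + ψ) (EuclideanSpace.single z (1 : ℝ)) - ∫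
        w', U' (matrixCLM A (WithLp.toLp 2 w') + ψ) (EuclideanSpace.single z (1 : ℝ)) ∂((volume : Measure (κ → ℝ)).tilted fun z => -(1 / 2 * (z
        ⬝ᵥ z) + U (matrixCLM A (WithLp.toLp 2 z) + ψ)))) * (U' (matrixCLM A (WithLp.toLp 2 w) + ψ) (EuclideanSpace.single t (1 : ℝ)) - ∫ w', U'
        (matrixCLM A (WithLp.toLp 2 w') + ψ) (EuclideanSpace.single t (1 : ℝ)) ∂((volume : Measure (κ → ℝ)).tilted fun z => -(1 / 2 * (z ⬝ᵥ z) +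
        U (matrixCLM A (WithLp.toLp 2 z) + ψ)))) * (U' (matrixCLM A (WithLp.toLp 2 w) + ψ) (EuclideanSpace.single s (1 : ℝ)) - ∫ w', U'
        (matrixCLM A (WithLp.toLp 2 w') + ψ) (EuclideanSpace.single s (1 : ℝ)) ∂((volume : Measure (κ → ℝ)).tilted fun z => -(1 / 2 * (z ⬝ᵥ z) +
        U (matrixCLM A (WithLp.toLp 2 z) + ψ)))) ∂((volume : Measure (κ → ℝ)).tilted fun z => -(1 / 2 * (z ⬝ᵥ z) + U (matrixCLM A (WithLp.toLp 2
        z) + ψ)))) - (∫ w, (P (matrixCLM A (WithLp.toLp 2 w) + ψ) - ∫ w', P (matrixCLM A (WithLp.toLp 2 w') + ψ) ∂((volume : Measure (κ →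
        ℝ)).tilted fun z => -(1 / 2 * (z ⬝ᵥ z) + U (matrixCLM A (WithLp.toLp 2 z) + ψ)))) * (U' (matrixCLM A (WithLp.toLp 2 w) + ψ)
        (EuclideanSpace.single z (1 : ℝ)) - ∫ w', U' (matrixCLM A (WithLp.toLp 2 w') + ψ) (EuclideanSpace.single z (1 : ℝ)) ∂((volume : Measure
        (κ → ℝ)).tilted fun z => -(1 / 2 * (z ⬝ᵥ z) + U (matrixCLM A (WithLp.toLp 2 z) + ψ)))) ∂((volume : Measure (κ → ℝ)).tilted fun z => -(1 /
        2 * (z ⬝ᵥ z) + U (matrixCLM A (WithLp.toLp 2 z) + ψ)))) * (∫ w, (U' (matrixCLM A (WithLp.toLp 2 w) + ψ) (EuclideanSpace.single t (1 : ℝ))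
        - ∫ w', U' (matrixCLM A (WithLp.toLp 2 w') + ψ) (EuclideanSpace.single t (1 : ℝ)) ∂((volume : Measure (κ → ℝ)).tilted fun z => -(1 / 2 *
        (z ⬝ᵥ z) + U (matrixCLM A (WithLp.toLp 2 z) + ψ)))) * (U' (matrixCLM A (WithLp.toLp 2 w) + ψ) (EuclideanSpace.single s (1 : ℝ)) - ∫ w',
        U' (matrixCLM A (WithLp.toLp 2 w') + ψ) (EuclideanSpace.single s (1 : ℝ)) ∂((volume : Measure (κ → ℝ)).tilted fun z => -(1 / 2 * (z ⬝ᵥ z)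
        + U (matrixCLM A (WithLp.toLp 2 z) + ψ)))) ∂((volume : Measure (κ → ℝ)).tilted fun z => -(1 / 2 * (z ⬝ᵥ z) + U (matrixCLM A (WithLp.toLp
        2 z) + ψ)))) - (∫ w, (P (matrixCLM A (WithLp.toLp 2 w) + ψ) - ∫ w', P (matrixCLM A (WithLp.toLp 2 w') + ψ) ∂((volume : Measure (κ →
        ℝ)).tilted fun z => -(1 / 2 * (z ⬝ᵥ z) + U (matrixCLM A (WithLp.toLp 2 z) + ψ)))) * (U' (matrixCLM A (WithLp.toLp 2 w) + ψ)
        (EuclideanSpace.single t (1 : ℝ)) - ∫ w', U' (matrixCLM A (WithLp.toLp 2 w') + ψ) (EuclideanSpace.single t (1 : ℝ)) ∂((volume : Measure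
        (κ → ℝ)).tilted fun z => -(1 / 2 * (z ⬝ᵥ z) + U (matrixCLM A (WithLp.toLp 2 z) + ψ)))) ∂((volume : Measure (κ → ℝ)).tilted fun z => -(1 /
        2 * (z ⬝ᵥ z) + U (matrixCLM A (WithLp.toLp 2 z) + ψ)))) * (∫ w, (U' (matrixCLM A (WithLp.toLp 2 w) + ψ) (EuclideanSpace.single z (1 : ℝ))
        - ∫ w', U' (matrixCLM A (WithLp.toLp 2 w') + ψ) (EuclideanSpace.single z (1 : ℝ)) ∂((volume : Measure (κ → ℝ)).tilted fun z => -(1 / 2 *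
        (z ⬝ᵥ z) + U (matrixCLM A (WithLp.toLp 2 z) + ψ)))) * (U' (matrixCLM A (WithLp.toLp 2 w) + ψ) (EuclideanSpace.single s (1 : ℝ)) - ∫ w',
        U' (matrixCLM A (WithLp.toLp 2 w') + ψ) (EuclideanSpace.single s (1 : ℝ)) ∂((volume : Measure (κ → ℝ)).tilted fun z => -(1 / 2 * (z ⬝ᵥ z)
        + U (matrixCLM A (WithLp.toLp 2 z) + ψ)))) ∂((volume : Measure (κ → ℝ)).tilted fun z => -(1 / 2 * (z ⬝ᵥ z) + U (matrixCLM A (WithLp.toLp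
        2 z) + ψ)))) - (∫ w, (P (matrixCLM A (WithLp.toLp 2 w) + ψ) - ∫ w', P (matrixCLM A (WithLp.toLp 2 w') + ψ) ∂((volume : Measure (κ →
        ℝ)).tilted fun z => -(1 / 2 * (z ⬝ᵥ z) + U (matrixCLM A (WithLp.toLp 2 z) + ψ)))) * (U' (matrixCLM A (WithLp.toLp 2 w) + ψ)
        (EuclideanSpace.single s (1 : ℝ)) - ∫ w', U' (matrixCLM A (WithLp.toLp 2 w') + ψ) (EuclideanSpace.single s (1 : ℝ)) ∂((volume : Measure
        (κ → ℝ)).tilted fun z => -(1 / 2 * (z ⬝ᵥ z) + U (matrixCLM A (WithLp.toLp 2 z) + ψ)))) ∂((volume : Measure (κ → ℝ)).tilted fun z => -(1 /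
        2 * (z ⬝ᵥ z) + U (matrixCLM A (WithLp.toLp 2 z) + ψ)))) * (∫ w, (U' (matrixCLM A (WithLp.toLp 2 w) + ψ) (EuclideanSpace.single z (1 : ℝ))
        - ∫ w', U' (matrixCLM A (WithLp.toLp 2 w') + ψ) (EuclideanSpace.single z (1 : ℝ)) ∂((volume : Measure (κ → ℝ)).tilted fun z => -(1 / 2 *
        (z ⬝ᵥ z) + U (matrixCLM A (WithLp.toLp 2 z) + ψ)))) * (U' (matrixCLM A (WithLp.toLp 2 w) + ψ) (EuclideanSpace.single t (1 : ℝ)) - ∫ w',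
        U' (matrixCLM A (WithLp.toLp 2 w') + ψ) (EuclideanSpace.single t (1 : ℝ)) ∂((volume : Measure (κ → ℝ)).tilted fun z => -(1 / 2 * (z ⬝ᵥ z)
        + U (matrixCLM A (WithLp.toLp 2 z) + ψ)))) ∂((volume : Measure (κ → ℝ)).tilted fun z => -(1 / 2 * (z ⬝ᵥ z) + U (matrixCLM A (WithLp.toLp
        2 z) + ψ))))| ≤
      8 * β * (Real.sqrt (5 * (κ₂ ^ 4 * γop ^ 2) / (1 - lam * γop) ^ 2) * Real.sqrt (Real.sqrt (5 * (κ₂ ^ 4 * γop ^ 2) / (1 - lam * γop) ^ 2)))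
        := by
  haveI : Nonempty ι := ⟨z⟩
  have hUc : Continuous U := continuous_iff_continuousAt.2 fun φ => (hUd φ).continuousAt
  have hU'c : Continuous U' := continuous_iff_continuousAt.2 fun φ => (hU'd φ).continuousAt
  have hγop := op_letter_nonneg hΓop
  have hκθ₀ : 2 * κ₀ * (1 + τ) * γop ≤ θp := mul_opBound_le_of_le (by positivity) (by linarith) hθ0.le hκθ
  have hI0 := whitened_exp_integrable hΓop Y hUc.measurable hκ₀ hτ hθ1 hκθ₀ hstab ψ
  have hV0 : Integrable (fun z : κ → ℝ => exp (-(1 / 2 * (z ⬝ᵥ z) + U (matrixCLM A (WithLp.toLp 2 z) + ψ)))) := by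
    have h := whitened_integrable_lebesgue A ψ (k := fun _ => (1 : ℝ)) (by simpa only [mul_one] using hI0)
    simpa only [one_mul] using h
  haveI : IsProbabilityMeasure ((volume : Measure (κ → ℝ)).tilted fun z => -(1 / 2 * (z ⬝ᵥ z) + U (matrixCLM A (WithLp.toLp 2 z) + ψ))) :=
    isProbabilityMeasure_tilted hV0
  have h4 := fun v => whitened_fourth_moment_gibbs hΓop Y hUd hU'd hU''c hκ₀ hκ₁ ha hτ hδ hθ0 hθ1 hκθ hstab hU'b hU''b hlam hUsec hρ ψ v
  have hI4 := fun v c => whitened_fourth_power_integrable hΓop Y hUd hU'd hκ₀ hκ₁ ha hτ hδ hθ0 hθ1 hκθ hstab hU'b ψ v c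
  have hsh : Continuous fun w : κ → ℝ => matrixCLM A (WithLp.toLp 2 w) + ψ :=
    ((matrixCLM A).continuous.comp (PiLp.continuous_toLp 2 _)).add continuous_const
  have hFm : ∀ (v : ι) (c : ℝ), AEStronglyMeasurable (fun w : κ → ℝ => U' (matrixCLM A (WithLp.toLp 2 w) + ψ) (EuclideanSpace.single v (1 : ℝ))
      - c) ((volume : Measure (κ → ℝ)).tilted fun z => -(1 / 2 * (z ⬝ᵥ z) + U (matrixCLM A (WithLp.toLp 2 z) + ψ))) :=
    fun v c => (((hU'c.comp hsh).clm_apply continuous_const).sub continuous_const).aestronglyMeasurable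
  have hB := fun w : κ → ℝ => abs_sub_integral_le (ν := (volume : Measure (κ → ℝ)).tilted fun z => -(1 / 2 * (z ⬝ᵥ z) + U (matrixCLM A
    (WithLp.toLp 2 z) + ψ))) (P := fun w' => P (matrixCLM A (WithLp.toLp 2 w') + ψ)) (fun w' => hP _) w
  exact centred_quad_le_of_bounded_first hβ hB (hFm z _) (hFm t _) (hFm s _) (hI4 z _) (hI4 t _) (hI4 s _) (h4 z) (h4 t) (h4 s)

/-- **FOUR-POINT DISPLAY, BOUNDED VERTEX SECOND (Gibbs format)**: tilt leg `x` first, then `P`, legs `t, s`: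
`|E[X̂P̂T̂Ŝ] − E[X̂P̂]E[T̂Ŝ] − E[X̂T̂]E[P̂Ŝ] − E[X̂Ŝ]E[P̂T̂]| ≤ 8β·√M₁·√√M₁`. [folklore] -/
theorem gibbs_quad_vertex_second [Nonempty κ] (hΓop : (γop • (1 : Matrix ι ι ℝ) - A * Aᵀ).PosSemidef) (Y : Finset ι)
    (hUd : ∀ φ : EuclideanSpace ℝ ι, HasFDerivAt U (U' φ) φ) (hU'd : ∀ φ : EuclideanSpace ℝ ι, HasFDerivAt U' (U'' φ) φ) (hU''c : Continuous U'')
    (hκ₀ : 0 ≤ κ₀) (hκ₁ : 0 ≤ κ₁) (ha : 0 ≤ a) (hτ : 0 < τ) (hδ : 0 < δ) (hθ0 : 0 < θp) (hθ1 : θp < 1) (hκθ : (2 * κ₀ * (1 + τ) + 4 * δ) * γop ≤ θp)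
    (hstab : ∀ φ : EuclideanSpace ℝ ι, -(κ₀ * ∑ x ∈ Y, φ x ^ 2) ≤ U φ) (hU'b : ∀ φ : EuclideanSpace ℝ ι, ‖U' φ‖ ≤ κ₁ * (a + ∑ x ∈ Y, φ x ^ 2))
    (hU''b : ∀ φ : EuclideanSpace ℝ ι, ‖U'' φ‖ ≤ κ₂) (hlam : 0 ≤ lam)
    (hUsec : ∀ s : ℝ, 0 ≤ s → s ≤ 1 → ∀ a b : EuclideanSpace ℝ ι, U ((1 - s) • a + s • b) - lam / 2 * (s * (1 - s)) * ∑ i, (a i - b i) ^ 2 ≤ (1 -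
        s) * U a + s * U b)
    (hρ : lam * γop < 1) {P : EuclideanSpace ℝ ι → ℝ} {β : ℝ} (hβ : 0 ≤ β) (hP : ∀ φ, |P φ| ≤ β) (ψ : EuclideanSpace ℝ ι) (x t s : ι) :
    |(∫ w, (U' (matrixCLM A (WithLp.toLp 2 w) + ψ) (EuclideanSpace.single x (1 : ℝ)) - ∫ w', U' (matrixCLM A (WithLp.toLp 2 w') + ψ)
        (EuclideanSpace.single x (1 : ℝ)) ∂((volume : Measure (κ → ℝ)).tilted fun z => -(1 / 2 * (z ⬝ᵥ z) + U (matrixCLM A (WithLp.toLp 2 z) +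
        ψ)))) * (P (matrixCLM A (WithLp.toLp 2 w) + ψ) - ∫ w', P (matrixCLM A (WithLp.toLp 2 w') + ψ) ∂((volume : Measure (κ → ℝ)).tilted fun z
        => -(1 / 2 * (z ⬝ᵥ z) + U (matrixCLM A (WithLp.toLp 2 z) + ψ)))) * (U' (matrixCLM A (WithLp.toLp 2 w) + ψ) (EuclideanSpace.single t (1 :
        ℝ)) - ∫ w', U' (matrixCLM A (WithLp.toLp 2 w') + ψ) (EuclideanSpace.single t (1 : ℝ)) ∂((volume : Measure (κ → ℝ)).tilted fun z => -(1 /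
        2 * (z ⬝ᵥ z) + U (matrixCLM A (WithLp.toLp 2 z) + ψ)))) * (U' (matrixCLM A (WithLp.toLp 2 w) + ψ) (EuclideanSpace.single s (1 : ℝ)) - ∫
        w', U' (matrixCLM A (WithLp.toLp 2 w') + ψ) (EuclideanSpace.single s (1 : ℝ)) ∂((volume : Measure (κ → ℝ)).tilted fun z => -(1 / 2 * (z
        ⬝ᵥ z) + U (matrixCLM A (WithLp.toLp 2 z) + ψ)))) ∂((volume : Measure (κ → ℝ)).tilted fun z => -(1 / 2 * (z ⬝ᵥ z) + U (matrixCLM A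
        (WithLp.toLp 2 z) + ψ)))) - (∫ w, (U' (matrixCLM A (WithLp.toLp 2 w) + ψ) (EuclideanSpace.single x (1 : ℝ)) - ∫ w', U' (matrixCLM A
        (WithLp.toLp 2 w') + ψ) (EuclideanSpace.single x (1 : ℝ)) ∂((volume : Measure (κ → ℝ)).tilted fun z => -(1 / 2 * (z ⬝ᵥ z) + U (matrixCLM
        A (WithLp.toLp 2 z) + ψ)))) * (P (matrixCLM A (WithLp.toLp 2 w) + ψ) - ∫ w', P (matrixCLM A (WithLp.toLp 2 w') + ψ) ∂((volume : Measure
        (κ → ℝ)).tilted fun z => -(1 / 2 * (z ⬝ᵥ z) + U (matrixCLM A (WithLp.toLp 2 z) + ψ)))) ∂((volume : Measure (κ → ℝ)).tilted fun z => -(1 /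
        2 * (z ⬝ᵥ z) + U (matrixCLM A (WithLp.toLp 2 z) + ψ)))) * (∫ w, (U' (matrixCLM A (WithLp.toLp 2 w) + ψ) (EuclideanSpace.single t (1 : ℝ))
        - ∫ w', U' (matrixCLM A (WithLp.toLp 2 w') + ψ) (EuclideanSpace.single t (1 : ℝ)) ∂((volume : Measure (κ → ℝ)).tilted fun z => -(1 / 2 *
        (z ⬝ᵥ z) + U (matrixCLM A (WithLp.toLp 2 z) + ψ)))) * (U' (matrixCLM A (WithLp.toLp 2 w) + ψ) (EuclideanSpace.single s (1 : ℝ)) - ∫ w',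
        U' (matrixCLM A (WithLp.toLp 2 w') + ψ) (EuclideanSpace.single s (1 : ℝ)) ∂((volume : Measure (κ → ℝ)).tilted fun z => -(1 / 2 * (z ⬝ᵥ z)
        + U (matrixCLM A (WithLp.toLp 2 z) + ψ)))) ∂((volume : Measure (κ → ℝ)).tilted fun z => -(1 / 2 * (z ⬝ᵥ z) + U (matrixCLM A (WithLp.toLp
        2 z) + ψ)))) - (∫ w, (U' (matrixCLM A (WithLp.toLp 2 w) + ψ) (EuclideanSpace.single x (1 : ℝ)) - ∫ w', U' (matrixCLM A (WithLp.toLp 2 w')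
        + ψ) (EuclideanSpace.single x (1 : ℝ)) ∂((volume : Measure (κ → ℝ)).tilted fun z => -(1 / 2 * (z ⬝ᵥ z) + U (matrixCLM A (WithLp.toLp 2 z)
        + ψ)))) * (U' (matrixCLM A (WithLp.toLp 2 w) + ψ) (EuclideanSpace.single t (1 : ℝ)) - ∫ w', U' (matrixCLM A (WithLp.toLp 2 w') + ψ)
        (EuclideanSpace.single t (1 : ℝ)) ∂((volume : Measure (κ → ℝ)).tilted fun z => -(1 / 2 * (z ⬝ᵥ z) + U (matrixCLM A (WithLp.toLp 2 z) +
        ψ)))) ∂((volume : Measure (κ → ℝ)).tilted fun z => -(1 / 2 * (z ⬝ᵥ z) + U (matrixCLM A (WithLp.toLp 2 z) + ψ)))) * (∫ w, (P (matrixCLM A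
        (WithLp.toLp 2 w) + ψ) - ∫ w', P (matrixCLM A (WithLp.toLp 2 w') + ψ) ∂((volume : Measure (κ → ℝ)).tilted fun z => -(1 / 2 * (z ⬝ᵥ z) + U
        (matrixCLM A (WithLp.toLp 2 z) + ψ)))) * (U' (matrixCLM A (WithLp.toLp 2 w) + ψ) (EuclideanSpace.single s (1 : ℝ)) - ∫ w', U' (matrixCLM
        A (WithLp.toLp 2 w') + ψ) (EuclideanSpace.single s (1 : ℝ)) ∂((volume : Measure (κ → ℝ)).tilted fun z => -(1 / 2 * (z ⬝ᵥ z) + U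
        (matrixCLM A (WithLp.toLp 2 z) + ψ)))) ∂((volume : Measure (κ → ℝ)).tilted fun z => -(1 / 2 * (z ⬝ᵥ z) + U (matrixCLM A (WithLp.toLp 2 z)
        + ψ)))) - (∫ w, (U' (matrixCLM A (WithLp.toLp 2 w) + ψ) (EuclideanSpace.single x (1 : ℝ)) - ∫ w', U' (matrixCLM A (WithLp.toLp 2 w') + ψ)
        (EuclideanSpace.single x (1 : ℝ)) ∂((volume : Measure (κ → ℝ)).tilted fun z => -(1 / 2 * (z ⬝ᵥ z) + U (matrixCLM A (WithLp.toLp 2 z) +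
        ψ)))) * (U' (matrixCLM A (WithLp.toLp 2 w) + ψ) (EuclideanSpace.single s (1 : ℝ)) - ∫ w', U' (matrixCLM A (WithLp.toLp 2 w') + ψ)
        (EuclideanSpace.single s (1 : ℝ)) ∂((volume : Measure (κ → ℝ)).tilted fun z => -(1 / 2 * (z ⬝ᵥ z) + U (matrixCLM A (WithLp.toLp 2 z) +
        ψ)))) ∂((volume : Measure (κ → ℝ)).tilted fun z => -(1 / 2 * (z ⬝ᵥ z) + U (matrixCLM A (WithLp.toLp 2 z) + ψ)))) * (∫ w, (P (matrixCLM A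
        (WithLp.toLp 2 w) + ψ) - ∫ w', P (matrixCLM A (WithLp.toLp 2 w') + ψ) ∂((volume : Measure (κ → ℝ)).tilted fun z => -(1 / 2 * (z ⬝ᵥ z) + U
        (matrixCLM A (WithLp.toLp 2 z) + ψ)))) * (U' (matrixCLM A (WithLp.toLp 2 w) + ψ) (EuclideanSpace.single t (1 : ℝ)) - ∫ w', U' (matrixCLM
        A (WithLp.toLp 2 w') + ψ) (EuclideanSpace.single t (1 : ℝ)) ∂((volume : Measure (κ → ℝ)).tilted fun z => -(1 / 2 * (z ⬝ᵥ z) + U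
        (matrixCLM A (WithLp.toLp 2 z) + ψ)))) ∂((volume : Measure (κ → ℝ)).tilted fun z => -(1 / 2 * (z ⬝ᵥ z) + U (matrixCLM A (WithLp.toLp 2 z)
        + ψ))))| ≤
      8 * β * (Real.sqrt (5 * (κ₂ ^ 4 * γop ^ 2) / (1 - lam * γop) ^ 2) * Real.sqrt (Real.sqrt (5 * (κ₂ ^ 4 * γop ^ 2) / (1 - lam * γop) ^ 2)))
        := by
  haveI : Nonempty ι := ⟨x⟩
  have hUc : Continuous U := continuous_iff_continuousAt.2 fun φ => (hUd φ).continuousAt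
  have hU'c : Continuous U' := continuous_iff_continuousAt.2 fun φ => (hU'd φ).continuousAt
  have hγop := op_letter_nonneg hΓop
  have hκθ₀ : 2 * κ₀ * (1 + τ) * γop ≤ θp := mul_opBound_le_of_le (by positivity) (by linarith) hθ0.le hκθ
  have hI0 := whitened_exp_integrable hΓop Y hUc.measurable hκ₀ hτ hθ1 hκθ₀ hstab ψ
  have hV0 : Integrable (fun z : κ → ℝ => exp (-(1 / 2 * (z ⬝ᵥ z) + U (matrixCLM A (WithLp.toLp 2 z) + ψ)))) := by
    have h := whitened_integrable_lebesgue A ψ (k := fun _ => (1 : ℝ)) (by simpa only [mul_one] using hI0)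
    simpa only [one_mul] using h
  haveI : IsProbabilityMeasure ((volume : Measure (κ → ℝ)).tilted fun z => -(1 / 2 * (z ⬝ᵥ z) + U (matrixCLM A (WithLp.toLp 2 z) + ψ))) :=
    isProbabilityMeasure_tilted hV0
  have h4 := fun v => whitened_fourth_moment_gibbs hΓop Y hUd hU'd hU''c hκ₀ hκ₁ ha hτ hδ hθ0 hθ1 hκθ hstab hU'b hU''b hlam hUsec hρ ψ v
  have hI4 := fun v c => whitened_fourth_power_integrable hΓop Y hUd hU'd hκ₀ hκ₁ ha hτ hδ hθ0 hθ1 hκθ hstab hU'b ψ v c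
  have hsh : Continuous fun w : κ → ℝ => matrixCLM A (WithLp.toLp 2 w) + ψ :=
    ((matrixCLM A).continuous.comp (PiLp.continuous_toLp 2 _)).add continuous_const
  have hFm : ∀ (v : ι) (c : ℝ), AEStronglyMeasurable (fun w : κ → ℝ => U' (matrixCLM A (WithLp.toLp 2 w) + ψ) (EuclideanSpace.single v (1 : ℝ))
      - c) ((volume : Measure (κ → ℝ)).tilted fun z => -(1 / 2 * (z ⬝ᵥ z) + U (matrixCLM A (WithLp.toLp 2 z) + ψ))) :=
    fun v c => (((hU'c.comp hsh).clm_apply continuous_const).sub continuous_const).aestronglyMeasurable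
  have hB := fun w : κ → ℝ => abs_sub_integral_le (ν := (volume : Measure (κ → ℝ)).tilted fun z => -(1 / 2 * (z ⬝ᵥ z) + U (matrixCLM A
    (WithLp.toLp 2 z) + ψ))) (P := fun w' => P (matrixCLM A (WithLp.toLp 2 w') + ψ)) (fun w' => hP _) w
  exact centred_quad_le_of_bounded_second hβ hB (hFm x _) (hFm t _) (hFm s _) (hI4 x _) (hI4 t _) (hI4 s _) (h4 x) (h4 t) (h4 s)

/-! ## §3. Toy -/

/-- Toy (the constant in numbers): `β = 1`, `M₁ = 16`: `8·1·(√16·√√16) = 8·(4·2) = 64`. -/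
example : 8 * (1 : ℝ) * (Real.sqrt 16 * Real.sqrt (Real.sqrt 16)) = 64 := by
  rw [show (16 : ℝ) = 4 ^ 2 by norm_num, Real.sqrt_sq (by norm_num), show (4 : ℝ) = 2 ^ 2 by norm_num, Real.sqrt_sq (by norm_num)]
  norm_num

end Summit.QuantumFields.BalabanUV.T4Continuum.NE7b.SupHomogeneousFourPointBounds

end
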